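import Summits.CriticalPhenomena.PercolationContinuityZ3.Theorems.PercNearOneGluingNoHeavyLowerTailQ44bMixedReduction
import Literature.Probability.Percolation.MooreShannonInfluenceBoundGeneral
import HarnessLib

/-!
# `Q44b` pencil at `a`: tools for the base case of the stripping induction

Support file for crux `stmt-CriticalPhenomena-4575` (quadratic four-point row `Q44b`, OPEN for all `n`), seat
`prim-l12-p6` gen 8; memo `run/shared/lean/prim/prim-l12/FROM-prim-l12-p6-g8-Q44B-MIXED-BERNSTEIN.md` §3–§4.
Used by `…Q44bPencilBase.lean` (base case) and `…Q44bStripping.lean` (the reduction `TC₁ ⇒ ND_a ⇒ Q44b`).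

* `Q44b.reachable_insert_iff_of_boundary` — if the only pair joining a vertex set `A` to its complement that may
  be open is `s(x,z)` (`x ∈ A`), then two vertices outside `A` are joined in `ω ∪ {s(x,z)}` iff they are joined in
  `ω ∖ {s(x,z)}` (a path through `s(x,z)` visits `x` and would need a second boundary pair; a path uses each pair once).
* `Q44b.bil_eq_zero_of_conn_one` — the bilinear form vanishes when a terminal is a.s. joined to `a` in both weightings.
* `Q44b.sureJoined_update_one`, `Q44b.real_update_one_eq_zero_of_ae` (from the tree's gluing identities
  `prodBernoulli_real_update_one_eq` / `_zero_eq`).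

Theorems only; no named facts, no sorries, standard axioms.
-/

noncomputable section

namespace Summit.CriticalPhenomena.PercolationContinuityZ3.Theorems

namespace Q44b

open MeasureTheory Set Literature.Probability.LatticeModels Literature.Probability.Percolation
open scoped Classical

variable {n : ℕ}


/-! ### A path that would use the only exit of a vertex set twice -/

/-- If every pair joining `A` to its complement that is open in `ω`, other than `s(x,z)` with `x ∈ A`, is absent,
then for two vertices OUTSIDE `A` reachability in `ω ∪ {s(x,z)}` and in `ω ∖ {s(x,z)}` coincide: a path through
`s(x,z)` visits `x ∈ A` and needs a second boundary pair to leave `A` again. [this work] -/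
theorem reachable_insert_iff_of_boundary (A : Set (Fin n)) {x z : Fin n} (hx : x ∈ A)
    (ω : BondConfig (Fin n))
    (hω : ∀ p q : Fin n, p ∈ A → q ∉ A → s(p, q) ∈ ω → s(p, q) = s(x, z))
    {t t' : Fin n} (ht : t ∉ A) (ht' : t' ∉ A) :
    (openGraph (insert s(x, z) ω)).Reachable t t' ↔ (openGraph (ω \ {s(x, z)})).Reachable t t' := by
  constructor
  · rintro ⟨p0⟩
    obtain ⟨p, hp⟩ := p0.reachable.exists_isPath
    -- every dart of `p` leaving `Aᶜ` into `A` carries the pair `s(x,z)`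
    have bnd : ∀ d : (openGraph (insert s(x, z) ω)).Dart, d.fst ∉ A → d.snd ∈ A → d.edge = s(x, z) := by
      intro d h1 h2
      have hadj := (openGraph_adj _ d.fst d.snd).1 d.adj
      have hde : d.edge = s(d.fst, d.snd) := rfl
      rw [hde]
      rcases hadj.1 with h | h
      · exact h
      · have := hω d.snd d.fst h2 h1 (by rwa [Sym2.eq_swap])
        rwa [Sym2.eq_swap] at this
    by_cases he : s(x, z) ∈ p.edges
    · -- the path visits `x`; both halves cross the boundary of `A`, hence both contain `s(x,z)`
      exfalso
      have hxp : x ∈ p.support := p.fst_mem_support_of_mem_edges he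
      set p₁ := p.takeUntil x hxp with hp₁
      set p₂ := p.dropUntil x hxp with hp₂
      have hedges : p.edges = p₁.edges ++ p₂.edges := by
        rw [← SimpleGraph.Walk.edges_append, SimpleGraph.Walk.take_spec]
      have hnd : (p₁.edges ++ p₂.edges).Nodup := hedges ▸ hp.edges_nodup
      obtain ⟨d₁, hd₁, hd₁S, hd₁A⟩ := p₁.exists_boundary_dart Aᶜ ht (fun h => h hx)
      obtain ⟨d₂, hd₂, hd₂S, hd₂A⟩ := p₂.reverse.exists_boundary_dart Aᶜ ht' (fun h => h hx)
      have e₁ : s(x, z) ∈ p₁.edges := by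
        have hm : d₁.edge ∈ p₁.edges := List.mem_map_of_mem hd₁
        rwa [bnd d₁ hd₁S (not_not.1 hd₁A)] at hm
      have e₂ : s(x, z) ∈ p₂.edges := by
        have hm : d₂.edge ∈ p₂.reverse.edges := List.mem_map_of_mem hd₂
        rw [bnd d₂ hd₂S (not_not.1 hd₂A), SimpleGraph.Walk.edges_reverse, List.mem_reverse] at hm
        exact hm
      exact List.disjoint_of_nodup_append hnd e₁ e₂
    · -- the path avoids `s(x,z)`: it lives in `ω ∖ {s(x,z)}`
      refine ⟨p.transfer (openGraph (ω \ {s(x, z)})) ?_⟩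
      intro f hf
      have hf' := p.edges_subset_edgeSet hf
      induction f using Sym2.ind with
      | h p' q' =>
        rw [SimpleGraph.mem_edgeSet] at hf' ⊢
        rw [openGraph_adj] at hf' ⊢
        refine ⟨⟨?_, ?_⟩, hf'.2⟩
        · rcases hf'.1 with h | h
          · rw [h] at hf; exact absurd hf he
          · exact h
        · intro h
          rw [mem_singleton_iff] at h
          rw [h] at hf; exact he hf
  · rintro h
    refine h.mono ?_
    exact SimpleGraph.fromEdgeSet_mono (fun f hf => Or.inr hf.1)

/-! ### Small measure-theoretic tools -/

/-- `bil w w' = 0` as soon as a terminal is almost surely joined to `a` under both weightings. [this work] -/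
theorem bil_eq_zero_of_conn_one (w w' : Sym2 (Fin n) → unitInterval) (a b c y t : Fin n)
    (ht : t = b ∨ t = c ∨ t = y)
    (hw : (prodBernoulli w).real (openConn a t) = 1) (hw' : (prodBernoulli w').real (openConn a t) = 1) :
    bil w w' a b c y = 0 := by
  unfold bil
  have cw : (prodBernoulli w).real (openConn a t)ᶜ = 0 := by rw [real_compl, hw]; ring
  have cw' : (prodBernoulli w').real (openConn a t)ᶜ = 0 := by rw [real_compl, hw']; ring
  rcases ht with rfl | rfl | rfl
  · -- t = b
    have e1 : (prodBernoulli w').real (evEmp a t c y) = 0 :=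
      real_eq_zero_of_subset w' (fun ω hω => hω.1.1.1.1.1) cw'
    have e2 : (prodBernoulli w').real (evX a t c y) = 0 :=
      real_eq_zero_of_subset w' (fun ω hω => hω.1) cw'
    have e3 : (prodBernoulli w').real (evCnA a t c y) = 0 :=
      real_eq_zero_of_subset w' (fun ω hω => hω.2) cw'
    have e4 : (prodBernoulli w).real (evPend a t c y) = 0 :=
      real_eq_zero_of_subset w (fun ω hω => hω.1.1.1.1) cw
    rw [e1, e2, e3, e4]; ring
  · -- t = c
    have e1 : (prodBernoulli w').real (evEmp a b t y) = 0 :=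
      real_eq_zero_of_subset w' (fun ω hω => hω.1.1.1.1.2) cw'
    have e2 : (prodBernoulli w).real (evAD a b t y) = 0 :=
      real_eq_zero_of_subset w (fun ω hω => hω.1.2) cw
    have e3 : (prodBernoulli w).real (evAB a b t y) = 0 :=
      real_eq_zero_of_subset w (fun ω hω => hω.1.1.2) cw
    have e4 : (prodBernoulli w).real (evPend a b t y) = 0 :=
      real_eq_zero_of_subset w (fun ω hω => hω.1.1.1.2) cw
    rw [e1, e2, e3, e4]; ring
  · -- t = y
    have e1 : (prodBernoulli w').real (evEmp a b c t) = 0 :=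
      real_eq_zero_of_subset w' (fun ω hω => hω.1.1.1.2) cw'
    have e2 : (prodBernoulli w).real (evAD a b c t) = 0 :=
      real_eq_zero_of_subset w (fun ω hω => hω.2) cw
    have e3 : (prodBernoulli w).real (evAB a b c t) = 0 :=
      real_eq_zero_of_subset w (fun ω hω => hω.1.2) cw
    have e4 : (prodBernoulli w).real (evPend a b c t) = 0 :=
      real_eq_zero_of_subset w (fun ω hω => hω.1.1.2) cw
    rw [e1, e2, e3, e4]; ring

/-- Raising a weight to one preserves sure joins. [folklore] -/
theorem sureJoined_update_one (w : Sym2 (Fin n) → unitInterval) (e : Sym2 (Fin n)) {a x : Fin n}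
    (h : sureJoined w a x) : sureJoined (Function.update w e 1) a x := by
  refine h.mono (SimpleGraph.fromEdgeSet_mono ?_)
  intro f hf
  simp only [mem_setOf_eq] at hf ⊢
  by_cases hfe : f = e
  · subst hfe; rw [Function.update_self]
  · rwa [Function.update_of_ne hfe]

/-- `P_{w[e↦1]}(E) = P_{w[e↦0]}(E)` as soon as, `P_w`-almost surely, membership of `ω ∪ {e}` and of `ω ∖ {e}` in
`E` agree (gluing identities `prodBernoulli_real_update_one_eq` / `_zero_eq`). [folklore] -/
theorem real_update_one_eq_zero_of_ae (w : Sym2 (Fin n) → unitInterval) (e : Sym2 (Fin n))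
    (E : Set (BondConfig (Fin n)))
    (h : ∀ᵐ ω ∂(prodBernoulli w), (insert e ω ∈ E ↔ ω \ {e} ∈ E)) :
    (prodBernoulli (Function.update w e 1)).real E = (prodBernoulli (Function.update w e 0)).real E := by
  have hE : DeterminedBy E (↑(Finset.univ : Finset (Sym2 (Fin n))) : Set (Sym2 (Fin n))) :=
    TargetExploration.determinedBy_univ E
  rw [prodBernoulli_real_update_one_eq hE w (Finset.mem_univ e),
    prodBernoulli_real_update_zero_eq hE w (Finset.mem_univ e)]
  exact measureReal_congr (h.mono fun ω hω => propext hω)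

end Q44b

end Summit.CriticalPhenomena.PercolationContinuityZ3.Theorems

end
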